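import Literature.AnabelianGeometry.SemiGraphs.TemperedDecompositionEmbeddingOfDomination
import Literature.AnabelianGeometry.SemiGraphs.TemperedDominationOfRestriction
import Literature.AnabelianGeometry.SemiGraphs.TemperedRestrictionFiniteSplitting
import Literature.AnabelianGeometry.SemiGraphs.TemperedPiChartExists
import HarnessLib

/-!
# The decomposition homomorphism `Π^tp_ℍ → Π^tp_𝔾` IS a closed topological embedding; [IUTchI] Prop. 2.2 (third
# inclusion) for general `ℍ` — assembly of row «DECOMP-EMB» ([IUTchI] §2 pp. 44–45; [SemiAnbd] Prop. 2.5 (i), §3)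

Mochizuki, *Inter-universal Teichmüller theory I*, §2 p. 44 l. 39–44 ("natural commutative diagram … of
[outer] inclusions … of topological groups") and Prop. 2.2 p. 45 ("`Π^tp_ℍ` is commensurably terminal in …
`Π^tp_𝔾`") [cite: Mochizuki2012, IUTchI Prop 2.2 p.45] [claim: Mochizuki2012, status: disputed]; Mochizuki,
*Semi-graphs of anabelioids*, Publ. RIMS **42** (2006), Prop. 2.5 (i) p. 27, Thm. 3.7 pp. 40–41
[cite: MochizukiSemiAnbd2006, Prop 2.5(i) p.27].

PROOF-ONLY ASSEMBLY (abc-iut cell, layer L3, row «DECOMP-EMB» / «DECOMP-CAPSTONE» = GAP-LEDGER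
G-w4d052-g5-1 / G-w5d028-2; composition drafted by seat abc-iut-w4-d052 gen 5, filed by seat abc-iut-L3-d1
gen 8 per the L3 lead's ruling γ17/γ19) of the three landed parts, all BY NAME:
(FIN) `finiteRestrictSplits` (`TemperedRestrictionFiniteSplitting.lean`, abc-iut-w4-d052: quasi-coherence +
trivialising covering) ⇒ (DOM) `dom_of_finiteRestrictSplits` (`TemperedDominationOfRestriction.lean`,
abc-iut-L3-d1: universal graph-coverings commute with restriction up to domination) ⇒ (EMB)
`IsDecompHom.isInducing_of_dom` (`TemperedDecompositionEmbeddingOfDomination.lean`, abc-iut-w4-d052: chart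
dictionary).  Results, for `𝒢` satisfying the hypotheses of [SemiAnbd] Thm. 3.7 (used: countable,
Galois-countable, quasi-coherent) and a sub-semi-graph `ℍ` with `𝒢_ℍ` satisfying them too (used: connected,
one verticial homomorphism):

* **`IsDecompHom.isInducing`** — every decomposition homomorphism `φ : π₁^temp(𝒢_ℍ) → π₁^temp(𝒢)` induces the
  topology; `IsDecompHom.isClosedEmbedding` — and is a closed embedding (injective, closed range);
* **`decompSubgroupsCommensurablyTerminal`** — [IUTchI] Prop. 2.2, third inclusion, for GENERAL `ℍ`: every
  decomposition subgroup `Π^tp_ℍ ∈ decompSubgroups c ℍ` is commensurably terminal in `π₁^temp(𝒢)`, from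
  Thm. 3.7's hypotheses for `𝒢`, `𝒢_ℍ` and Thm. 3.7 (iii) at `𝒢_ℍ` (`CompactInVerticialAt`; gone for finite
  `ℍ`, `decompSubgroupsCommensurablyTerminal_of_finite`) — NO embedding / domination / φ binder left (a chart
  of `𝒢_ℍ` exists by Prop. 3.6, `temperedPiChart`, and a decomposition homomorphism by `decompHomExists`);
* `isClosed_of_mem_decompSubgroups` — every decomposition subgroup is closed in `π₁^temp(𝒢)`.

Theorems only, no `def`; the [IUTchI] sentences are `[claim: Mochizuki2012, status: disputed]` items — PROVED
are the displayed statements about the tree's own objects; nothing here takes a side on [IUTchIII] Cor. 3.12.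
-/

namespace Literature.AnabelianGeometry.SemiGraphs

namespace ProfiniteSemiGraph

namespace TemperedPiChart

open CategoryTheory Topology
open Literature.AnabelianGeometry.AbsoluteAnabelian (IsCommensurablyTerminal)

universe u

variable {𝒢 : ProfiniteSemiGraph.{u}} {c : TemperedPiChart 𝒢} {H : 𝒢.graph.Subgraph}

/-- **THE EMBEDDING** ([IUTchI] §2 p. 44 "inclusions … of topological groups"): under Thm. 3.7's hypotheses
for `𝒢` and `𝒢_ℍ`, every decomposition homomorphism `φ : π₁^temp(𝒢_ℍ) → π₁^temp(𝒢)` induces the topology of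
`π₁^temp(𝒢_ℍ)` — (FIN) ∘ (DOM) ∘ (EMB) by name. [cite: Mochizuki2012, IUTchI §2 p.44] -/
theorem IsDecompHom.isInducing (h37 : 𝒢.Thm37Hypotheses) (h37H : (𝒢.restrict H).Thm37Hypotheses)
    {c' : TemperedPiChart (𝒢.restrict H)} {φ : c'.G →ₜ* c.G} (hφ : c.IsDecompHom H c' φ) :
    IsInducing φ :=
  hφ.isInducing_of_dom h37H (dom_of_finiteRestrictSplits H h37.isCountable h37.isGaloisCountable
    (finiteRestrictSplits h37.isQuasiCoherent H h37H.isConnected))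

/-- … hence a CLOSED EMBEDDING (injective with closed range). [cite: Mochizuki2012, IUTchI §2 p.44] -/
theorem IsDecompHom.isClosedEmbedding (h37 : 𝒢.Thm37Hypotheses) (h37H : (𝒢.restrict H).Thm37Hypotheses)
    {c' : TemperedPiChart (𝒢.restrict H)} {φ : c'.G →ₜ* c.G} (hφ : c.IsDecompHom H c' φ) :
    IsClosedEmbedding φ :=
  hφ.isClosedEmbedding_of_dom h37H (dom_of_finiteRestrictSplits H h37.isCountable h37.isGaloisCountable
    (finiteRestrictSplits h37.isQuasiCoherent H h37H.isConnected))

/-- **[IUTchI] Prop. 2.2, third inclusion, for a GENERAL sub-semi-graph `ℍ`**: every decomposition subgroup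
`Π^tp_ℍ ∈ decompSubgroups c ℍ` is commensurably terminal in `π₁^temp(𝒢)` — from the hypotheses of [SemiAnbd]
Thm. 3.7 for `𝒢` and `𝒢_ℍ` and Thm. 3.7 (iii) at `𝒢_ℍ`; no embedding, domination or homomorphism binder
remains (a chart of `𝒢_ℍ`: Prop. 3.6, `temperedPiChart`; a decomposition homomorphism: `decompHomExists`).
[cite: Mochizuki2012, IUTchI Prop 2.2 p.45] -/
theorem decompSubgroupsCommensurablyTerminal (h37 : 𝒢.Thm37Hypotheses)
    (h37H : (𝒢.restrict H).Thm37Hypotheses) (hCIV : CompactInVerticialAt (𝒢.restrict H)) :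
    c.DecompSubgroupsCommensurablyTerminal H := by
  obtain ⟨φ, hφ⟩ := c.decompHomExists H ((𝒢.restrict H).temperedPiChart h37H.toProp36Hypotheses)
  exact decompSubgroupsCommensurablyTerminal_of_isInducing h37 h37H hCIV hφ (hφ.isInducing h37 h37H)

/-- **… for finite `ℍ`**, where Thm. 3.7 (iii) at `𝒢_ℍ` is the tree's `compactInVerticialFin_holds`: the
binders are exactly the Thm. 3.7 hypothesis bundles of `𝒢` and `𝒢_ℍ`. [cite: Mochizuki2012, IUTchI Prop 2.2 p.45] -/
theorem decompSubgroupsCommensurablyTerminal_of_finite [hV : Finite H.toSemiGraph.Vertex]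
    [hE : Finite H.toSemiGraph.Edge] (h37 : 𝒢.Thm37Hypotheses) (h37H : (𝒢.restrict H).Thm37Hypotheses) :
    c.DecompSubgroupsCommensurablyTerminal H :=
  decompSubgroupsCommensurablyTerminal h37 h37H (@compactInVerticialFin_holds (𝒢.restrict H) hV hE)

/-- The commensurator form: `C_{π₁^temp(𝒢)}(D) = D` for every `D ∈ decompSubgroups c ℍ`, finite `ℍ`.
[cite: Mochizuki2012, IUTchI Prop 2.2 p.45] -/
theorem commensurator_eq_of_mem_decompSubgroups [Finite H.toSemiGraph.Vertex] [Finite H.toSemiGraph.Edge]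
    (h37 : 𝒢.Thm37Hypotheses) (h37H : (𝒢.restrict H).Thm37Hypotheses) {D : Subgroup c.G}
    (hD : D ∈ c.decompSubgroups H) : Subgroup.Commensurable.commensurator D = D :=
  (decompSubgroupsCommensurablyTerminal_of_finite h37 h37H D hD).commensurator_eq

/-- Every decomposition subgroup of `ℍ` is CLOSED in `π₁^temp(𝒢)` (the tempered part of [IUTchI] Cor. 2.3
(v)-type closedness). [cite: Mochizuki2012, IUTchI §2 p.44] -/
theorem isClosed_of_mem_decompSubgroups (h37 : 𝒢.Thm37Hypotheses) (h37H : (𝒢.restrict H).Thm37Hypotheses)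
    {D : Subgroup c.G} (hD : D ∈ c.decompSubgroups H) : IsClosed (D : Set c.G) := by
  obtain ⟨φ, hφ⟩ := c.decompHomExists H ((𝒢.restrict H).temperedPiChart h37H.toProp36Hypotheses)
  exact (isClosed_of_mem_decompSubgroups_of_isInducing hφ (hφ.isInducing h37 h37H) hD).2

end TemperedPiChart

end ProfiniteSemiGraph

end Literature.AnabelianGeometry.SemiGraphs
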